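import Summits.HubbardSuperconductivity.HubbardSuperconductivity.Theorems.ThermalWedgeTwSeededEnsembleEquivalenceROptimiserFloor
import Summits.HubbardSuperconductivity.HubbardSuperconductivity.Theorems.ThermalWedgeTwSeededEnsembleEquivalenceRSourcedPressureLimit
import Summits.HubbardSuperconductivity.HubbardSuperconductivity.Theorems.ThermalWedgeTwSeededEnsembleEquivalenceRSharpSectorEntropy
import Summits.HubbardSuperconductivity.HubbardSuperconductivity.Theorems.ThermalWedgeTwApproximatingHamiltonian
import Summits.HubbardSuperconductivity.HubbardSuperconductivity.Theorems.ThermalWedgeTwSeededEnsembleEquivalenceRPbSectorSelection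
import Summits.HubbardSuperconductivity.HubbardSuperconductivity.Theorems.ThermalWedgeTwSeededEnsembleEquivalenceRSectorWeightLipschitz
import Summits.HubbardSuperconductivity.HubbardSuperconductivity.Theorems.ThermalWedgeTwSeededEnsembleEquivalenceRBlockProduct
import Summits.HubbardSuperconductivity.HubbardSuperconductivity.Theorems.ThermalWedgeTwSeededEnsembleEquivalenceRLogPartitionCalculus
import Summits.HubbardSuperconductivity.HubbardSuperconductivity.Theorems.ThermalWedgeTwSeededEnsembleEquivalenceRColdSlice
import Literature.MathematicalPhysics.QuantumLattice.DuhamelTwoPoint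
import Literature.MathematicalPhysics.QuantumLattice.DuhamelEqualTimeBounds
import Literature.MathematicalPhysics.QuantumLattice.GibbsLinearResponse

/-!
# Crux `TwSeededEnsembleEquivalenceR` (stmt-HubbardSuperconductivity-15581), line `cold-floor-collapse` (slug `Sketch`),
# skeleton v8 (block two-phase pinning) — registered stub `stub_selectionTransfer`

Support file (`--supports stmt-HubbardSuperconductivity-15581`; sorry-free; no definition).
Abstract penalised sector selection + log-Lipschitz transfer with the optimised penalty (pure real analysis).
-/

set_option linter.dupNamespace false

namespace Summit.HubbardSuperconductivity.HubbardSuperconductivity.Theorems.TwSeededEnsembleEquivalenceR.ColdFloorLine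

open Matrix Filter Topology Finset Literature.MathematicalPhysics.QuantumLattice
open Literature.Barriers.HubbardSuperconductivity Literature.Probability.LatticeModels
open scoped ComplexOrder Matrix.Norms.L2Operator

noncomputable section

/-- Telescoping log-Lipschitz bound: along `K, K+1, …, K+k` inside `[N₁, N₂]` the log-weights move by at most
`D · k`. -/
private theorem st_telescope (W : ℕ → ℝ) (N₁ N₂ : ℕ) (D : ℝ)
    (hLip : ∀ N : ℕ, N₁ ≤ N → N + 1 ≤ N₂ → |Real.log (W (N + 1)) - Real.log (W N)| ≤ D) :
    ∀ (k K : ℕ), N₁ ≤ K → K + k ≤ N₂ →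
      |Real.log (W (K + k)) - Real.log (W K)| ≤ D * k := by
  intro k
  induction k with
  | zero =>
    intro K _ _
    simp
  | succ k ih =>
    intro K hK hKk
    have h1 : K + k ≤ N₂ := by omega
    have h2 := ih K hK h1
    have h3 := hLip (K + k) (by omega) (by omega)
    have e : K + (k + 1) = K + k + 1 := by omega
    rw [e]
    calc |Real.log (W (K + k + 1)) - Real.log (W K)|
        = |(Real.log (W (K + k + 1)) - Real.log (W (K + k))) +
            (Real.log (W (K + k)) - Real.log (W K))| := by ring_nf
      _ ≤ |Real.log (W (K + k + 1)) - Real.log (W (K + k))| +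
            |Real.log (W (K + k)) - Real.log (W K)| := abs_add_le _ _
      _ ≤ D + D * k := add_le_add h3 h2
      _ = D * ((k + 1 : ℕ) : ℝ) := by push_cast; ring

/-- Two-sided transfer: `|log W N − log W Nc| ≤ D · |N − Nc|` when both `N` and `Nc` lie in `[N₁, N₂]`. -/
private theorem st_transfer (W : ℕ → ℝ) (N₁ N₂ : ℕ) (D : ℝ)
    (hLip : ∀ N : ℕ, N₁ ≤ N → N + 1 ≤ N₂ → |Real.log (W (N + 1)) - Real.log (W N)| ≤ D)
    (N Nc : ℕ) (hN₁ : N₁ ≤ N) (hN₂ : N ≤ N₂) (hc₁ : N₁ ≤ Nc) (hc₂ : Nc ≤ N₂) :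
    |Real.log (W N) - Real.log (W Nc)| ≤ D * |(N : ℝ) - Nc| := by
  rcases le_total N Nc with h | h
  · obtain ⟨k, rfl⟩ := Nat.exists_eq_add_of_le h
    have hk := st_telescope W N₁ N₂ D hLip k N hN₁ hc₂
    have e : |((N : ℕ) : ℝ) - ((N + k : ℕ) : ℝ)| = (k : ℝ) := by
      rw [abs_sub_comm]
      push_cast
      rw [show (N : ℝ) + k - N = k by ring, Nat.abs_cast]
    rw [abs_sub_comm, e]
    exact hk
  · obtain ⟨k, rfl⟩ := Nat.exists_eq_add_of_le h
    have hk := st_telescope W N₁ N₂ D hLip k Nc hc₁ hN₂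
    have e : |((Nc + k : ℕ) : ℝ) - ((Nc : ℕ) : ℝ)| = (k : ℝ) := by
      push_cast
      rw [show (Nc : ℝ) + k - Nc = k by ring, Nat.abs_cast]
    rw [e]
    exact hk

/-- Completing the square: `D x − t x² ≤ D² / (4 t)` for `t > 0`, in the cleared form used below. -/
private theorem st_complete_square (D t x : ℝ) (ht : 0 < t) :
    D * x - t * x ^ 2 ≤ D ^ 2 / (4 * t) := by
  rw [le_div_iff₀ (by positivity)]
  nlinarith [sq_nonneg (2 * t * x - D)]

/-- **S7g `stub_selectionTransfer` (abstract: penalised selection + log-Lipschitz transfer, optimised penalty).** Weights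
`W(N) > 0` on `[N₁, N₂]`, `D`-log-Lipschitz there; a target `Nc` at distance `≥ m` from the ends; a selection principle
giving, for every penalty `t ≥ 0`, a sector `N` with `0 < W(N) ≤ Z` and `log Z − log W(N) ≤ A + tV + ℓ − t(N − Nc)²` (S1's output
shape); then with `t := D/(2√V)`: `(N − Nc)² ≤ A/t + V + ℓ/t ≤ m²` keeps the transfer path inside `[N₁, N₂]`, and
`log Z − log W(Nc) ≤ A + tV + ℓ + max_x (Dx − tx²) = A + ℓ + D√V`. [folklore] -/
theorem stub_selectionTransfer :
    ∀ (W : ℕ → ℝ) (N₁ N₂ Nc : ℕ) (Z A V ℓ D m : ℝ),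
      0 < Z → 0 ≤ A → 1 ≤ V → 0 ≤ ℓ → 0 < D → 0 ≤ m → (N₁ : ℝ) + m ≤ Nc → (Nc : ℝ) + m ≤ N₂ →
      (∀ N : ℕ, N₁ ≤ N → N ≤ N₂ → 0 < W N) →
      (∀ N : ℕ, N₁ ≤ N → N + 1 ≤ N₂ → |Real.log (W (N + 1)) - Real.log (W N)| ≤ D) →
      (∀ t : ℝ, 0 ≤ t → ∃ N : ℕ, 0 < W N ∧ W N ≤ Z ∧
        Real.log Z - Real.log (W N) ≤ A + t * V + ℓ - t * ((N : ℝ) - Nc) ^ 2) →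
      2 * A * Real.sqrt V / D + V + 2 * ℓ * Real.sqrt V / D ≤ m ^ 2 →
      Real.log Z - Real.log (W Nc) ≤ A + ℓ + D * Real.sqrt V := by
  intro W N₁ N₂ Nc Z A V ℓ D m _hZ hA hV hℓ hD hm hN₁ hN₂ _hpos hLip hsel hmsq
  -- the optimised penalty `t := D / (2 √V)`
  have hV0 : 0 ≤ V := by linarith
  have hs1 : 1 ≤ Real.sqrt V := Real.one_le_sqrt.mpr hV
  have hs0 : 0 < Real.sqrt V := by linarith
  have hsV : Real.sqrt V ^ 2 = V := Real.sq_sqrt hV0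
  set s := Real.sqrt V with hs_def
  have ht0 : 0 < D / (2 * s) := by positivity
  set t := D / (2 * s) with ht_def
  obtain ⟨N, hWN, hWZ, hbound⟩ := hsel t ht0.le
  -- the selected sector is within distance `m` of `Nc`
  have hlog0 : 0 ≤ Real.log Z - Real.log (W N) := by
    have := Real.log_le_log hWN hWZ
    linarith
  have hx0 : 0 ≤ |(N : ℝ) - Nc| := abs_nonneg _
  have hxsq : ((N : ℝ) - Nc) ^ 2 = |(N : ℝ) - Nc| ^ 2 := (sq_abs _).symm
  set x := |(N : ℝ) - Nc| with hx_def
  have h1 : t * x ^ 2 ≤ A + t * V + ℓ := by nlinarith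
  have htA : t * (2 * A * s / D) = A := by
    rw [ht_def]; field_simp
  have htℓ : t * (2 * ℓ * s / D) = ℓ := by
    rw [ht_def]; field_simp
  have h2 : t * x ^ 2 ≤ t * m ^ 2 := by
    have := mul_le_mul_of_nonneg_left hmsq ht0.le
    nlinarith
  have h3 : ((N : ℝ) - Nc) ^ 2 ≤ m ^ 2 := by
    rw [hxsq]; exact le_of_mul_le_mul_left h2 ht0
  have h4 := abs_le.mp (abs_le_of_sq_le_sq h3 hm)
  have hNlo : N₁ ≤ N := by
    have : (N₁ : ℝ) ≤ N := by linarith [h4.1]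
    exact_mod_cast this
  have hNhi : N ≤ N₂ := by
    have : (N : ℝ) ≤ N₂ := by linarith [h4.2]
    exact_mod_cast this
  have hclo : N₁ ≤ Nc := by
    have : (N₁ : ℝ) ≤ Nc := by linarith
    exact_mod_cast this
  have hchi : Nc ≤ N₂ := by
    have : (Nc : ℝ) ≤ N₂ := by linarith
    exact_mod_cast this
  -- log-Lipschitz transfer from `N` to `Nc`
  have hT : |Real.log (W N) - Real.log (W Nc)| ≤ D * x :=
    st_transfer W N₁ N₂ D hLip N Nc hNlo hNhi hclo hchi
  have hT' : Real.log (W N) - Real.log (W Nc) ≤ D * x := (le_abs_self _).trans hT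
  -- optimisation in `x` and evaluation at `t = D / (2 s)`
  have hsq : D * x - t * x ^ 2 ≤ D ^ 2 / (4 * t) := st_complete_square D t x ht0
  have htV : t * V = D * s / 2 := by
    rw [ht_def, ← hsV]; field_simp
  have hDt : D ^ 2 / (4 * t) = D * s / 2 := by
    rw [ht_def]; field_simp; ring
  calc Real.log Z - Real.log (W Nc)
      = (Real.log Z - Real.log (W N)) + (Real.log (W N) - Real.log (W Nc)) := by ring
    _ ≤ (A + t * V + ℓ - t * ((N : ℝ) - Nc) ^ 2) + D * x := add_le_add hbound hT'
    _ = A + ℓ + t * V + (D * x - t * x ^ 2) := by rw [hxsq]; ring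
    _ ≤ A + ℓ + D * s / 2 + D ^ 2 / (4 * t) := by rw [htV]; linarith
    _ = A + ℓ + D * s := by rw [hDt]; ring

end

end Summit.HubbardSuperconductivity.HubbardSuperconductivity.Theorems.TwSeededEnsembleEquivalenceR.ColdFloorLine
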